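import Mathlib
import Summits.NavierStokesRegularity.NavierStokesRegularity.Theorems.EulerZoomLiouvillePowerGaugeEulerLiouvilleMeanStrainTools
import HarnessLib

/-!
# Crux `EulerZoomLiouville.PowerGaugeEulerLiouville` (stmt-NavierStokesRegularity-19832): THE MEAN DISPLACEMENT LAW — plate t59-MD of nsreg-p2 ROUND-54 «THE TRACE»

Width/portrait piece for THE ONE STATEMENT `stub_selfSimilarC2Needle` (LEAD skeleton `Cruxes/PowerGaugeEulerLiouville/Lines/birth.lean` v111,
ns-typeII-p2 g16), `--supports stmt-NavierStokesRegularity-19832 --as helper`.  Text = nsreg-p2 g44's `NsregP2.R54.Trace.MeanDisplacementLaw ρ V`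
(`r54/Sketch54.lean` sha16 f78682d2f4ee3f27) VERBATIM with `simFlow` unfolded, for every `ρ > −2`.

For a self-similar Euler profile `(V, P)` with exponent `γ = 1/(2+ρ)`, centre `0`, in the A-GAUGE `∫_{B_R}‖V‖² ≤ A R^{1−2ρ}` (`R ≥ 1`), and the
lineage's cut-off idiom (`V′ ∈ C²`, `‖DV′‖ ≤ K`, `V′ = V` on `ball 0 Rbig`, flow `Ψ_s` of `γy + V′`): for `C, L ≥ 1` there is `M = M(A, C, L, ρ)` such
that for every horizon `S ≥ 0` (`2CLe^{γS} < Rbig`) the label-mean over `B_L` of the PHYSICAL path length `∫ e^{−γσ}‖V′(Ψ_σ y)‖ dσ` accumulated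
while the trajectory stays in the `CL`-tube is `≤ M`, uniformly in `S`, `V′`, `K`, `Rbig` (`meanDisplacementLaw`).  Same engine as t59-MS
(`…MeanStrainTools`): at a fixed `σ` the staying labels map injectively under `Ψ_σ` into `B̄(0, CLe^{γσ}) ⊆ B(0, 2CLe^{γσ})` with Jacobian `e^{3γσ}`,
Cauchy–Schwarz and the A-gauge at radius `2CLe^{γσ}` give the slice bound `(max A 0 · 2^{1−2ρ})^{1/2}(CL)^{2−ρ}|B_1|^{1/2} e^{−σ}`
(`displacement_bookkeeping`: `γ(2+ρ) = 1`), and `∫_0^S e^{−σ} ≤ 1`.  Reading (R54 §C): a.e. non-escaping particle has finite physical path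
length up to the blow-up time, hence a limiting position.

HONEST FRAMING: a portrait instrument about HYPOTHETICAL profiles; nothing about the crux E (19832 OPEN) or NS regularity is proved.
[nsreg-p2 R54 §C t59-MD; cite: ConstantinIgnatovaVicol2026Putative, §3.4.1 eq. (3.21)–(3.22)]
-/

noncomputable section

set_option linter.dupNamespace false

open MeasureTheory Set Filter Topology Metric Function
open scoped RealInnerProductSpace NNReal ENNReal ContDiff

namespace Summit.NavierStokesRegularity.NavierStokesRegularity.Theorems.PowerGaugeEulerLiouville.Trace

open Literature.Analysis Literature.Analysis.FluidPDE
open Summit.NavierStokesRegularity.NavierStokesRegularity.Theorems.PowerGaugeEulerLiouville.BernoulliLandscape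
open Summit.NavierStokesRegularity.NavierStokesRegularity.Theorems.PowerGaugeEulerLiouville.NeedleFeeding

/-- **The exponent identity `γ(2+ρ) = 1` at work**: `e^{−γσ} e^{−3γσ} (CLe^{γσ})^{2−ρ} = (CL)^{2−ρ} e^{−σ}`, `γ = 1/(2+ρ)`. [folklore] -/
theorem displacement_bookkeeping {ρ C L σ : ℝ} (h2ρ : 0 < 2 + ρ) (hCL : 0 ≤ C * L) :
    Real.exp (-(σ / (2 + ρ))) * (Real.exp (-(3 * (1 / (2 + ρ)) * σ)) * (C * L * Real.exp (σ / (2 + ρ))) ^ (2 - ρ)) =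
      (C * L) ^ (2 - ρ) * Real.exp (-σ) := by
  rw [Real.mul_rpow hCL (Real.exp_pos _).le, ← Real.exp_mul]
  have e : -(σ / (2 + ρ)) + (-(3 * (1 / (2 + ρ)) * σ) + σ / (2 + ρ) * (2 - ρ)) = -σ := by
    field_simp
    ring
  calc Real.exp (-(σ / (2 + ρ))) * (Real.exp (-(3 * (1 / (2 + ρ)) * σ)) *
        ((C * L) ^ (2 - ρ) * Real.exp (σ / (2 + ρ) * (2 - ρ))))
      = (C * L) ^ (2 - ρ) * (Real.exp (-(σ / (2 + ρ))) * (Real.exp (-(3 * (1 / (2 + ρ)) * σ)) *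
          Real.exp (σ / (2 + ρ) * (2 - ρ)))) := by ring
    _ = (C * L) ^ (2 - ρ) * Real.exp (-σ) := by rw [← Real.exp_add, ← Real.exp_add, e]

/-- `∫_{[0,S]} e^{−σ} dσ ≤ 1` (`S ≥ 0`), in `ℝ≥0∞`. [folklore] -/
theorem lintegral_exp_neg_Icc_le {S : ℝ} (hS : 0 ≤ S) :
    ∫⁻ σ in Icc 0 S, ENNReal.ofReal (Real.exp (-σ)) ≤ ENNReal.ofReal 1 := by
  have hc : Continuous fun σ : ℝ => Real.exp (-σ) := by fun_prop
  have hint : IntegrableOn (fun σ : ℝ => Real.exp (-σ)) (Icc 0 S) volume :=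
    hc.continuousOn.integrableOn_compact isCompact_Icc
  rw [← ofReal_integral_eq_lintegral_ofReal hint (ae_of_all _ fun σ => (Real.exp_pos _).le)]
  refine ENNReal.ofReal_le_ofReal ?_
  rw [integral_Icc_eq_integral_Ioc, ← intervalIntegral.integral_of_le hS]
  have hderiv : ∀ x ∈ uIcc 0 S, HasDerivAt (fun σ : ℝ => -Real.exp (-σ)) (Real.exp (-x)) x := by
    intro x _
    have h := ((hasDerivAt_neg x).exp).neg
    refine h.congr_deriv ?_
    ring
  rw [intervalIntegral.integral_eq_sub_of_hasDerivAt hderiv (hc.intervalIntegrable 0 S)]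
  simp only [neg_zero, Real.exp_zero]
  have hpos : 0 < Real.exp (-S) := Real.exp_pos _
  linarith

/-- **The A-gauge in `ℝ≥0∞` on closed balls**: for a continuous `V` with `∫_{B_R}‖V‖² ≤ A R^{1−2ρ}` (`R ≥ 1`) and `R ≥ 1`,
`∫⁻_{B̄_R} ‖V‖ₑ² ≤ ofReal (A (2R)^{1−2ρ})` (via `B̄_R ⊆ B_{2R}`). [folklore] -/
theorem lintegral_closedBall_enorm_sq_le_of_gauge {ρ A R : ℝ} {V : EuclideanSpace ℝ (Fin 3) → EuclideanSpace ℝ (Fin 3)}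
    (hV : Continuous V)
    (hA : ∀ R : ℝ, 1 ≤ R → ∫ y in ball (0 : EuclideanSpace ℝ (Fin 3)) R, ‖V y‖ ^ 2 ≤ A * R ^ (1 - 2 * ρ)) (hR : 1 ≤ R) :
    ∫⁻ z in closedBall (0 : EuclideanSpace ℝ (Fin 3)) R, ‖V z‖ₑ ^ 2 ≤ ENNReal.ofReal (A * (2 * R) ^ (1 - 2 * ρ)) := by
  have hsub : closedBall (0 : EuclideanSpace ℝ (Fin 3)) R ⊆ ball (0 : EuclideanSpace ℝ (Fin 3)) (2 * R) :=
    closedBall_subset_ball (by linarith)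
  have hint : IntegrableOn (fun y => ‖V y‖ ^ 2) (ball (0 : EuclideanSpace ℝ (Fin 3)) (2 * R)) volume :=
    ((hV.norm.pow 2).continuousOn.integrableOn_compact (isCompact_closedBall (0 : EuclideanSpace ℝ (Fin 3)) (2 * R))).mono_set
      ball_subset_closedBall
  calc ∫⁻ z in closedBall (0 : EuclideanSpace ℝ (Fin 3)) R, ‖V z‖ₑ ^ 2
      ≤ ∫⁻ z in ball (0 : EuclideanSpace ℝ (Fin 3)) (2 * R), ‖V z‖ₑ ^ 2 := lintegral_mono_set hsub
    _ = ∫⁻ z in ball (0 : EuclideanSpace ℝ (Fin 3)) (2 * R), ENNReal.ofReal (‖V z‖ ^ 2) := by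
        refine lintegral_congr fun z => ?_
        rw [ENNReal.ofReal_pow (norm_nonneg _), ofReal_norm]
    _ = ENNReal.ofReal (∫ z in ball (0 : EuclideanSpace ℝ (Fin 3)) (2 * R), ‖V z‖ ^ 2) :=
        (ofReal_integral_eq_lintegral_ofReal hint (ae_of_all _ fun z => sq_nonneg _)).symm
    _ ≤ ENNReal.ofReal (A * (2 * R) ^ (1 - 2 * ρ)) := ENNReal.ofReal_le_ofReal (hA (2 * R) (by linarith))

/-- **The displacement of the staying labels at a fixed time.**  In the cut-off idiom and the A-gauge, for `σ ∈ [0, S]` the labels `y ∈ B_L`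
whose orbit stays in the `CL`-tube on `[0, σ]` satisfy `∫ ‖V′(Ψ_σ y)‖ dy ≤ e^{−3γσ}(A 2^{1−2ρ})^{1/2}(CLe^{γσ})^{2−ρ}|B_1|^{1/2}`:
area formula with Jacobian `e^{3γσ}`, image in `B̄(0, CLe^{γσ})` where `V′ = V`, Cauchy–Schwarz, A-gauge at radius `2CLe^{γσ}`.
[nsreg-p2 R54 §C t59-MD; cite: ConstantinIgnatovaVicol2026Putative, §3.4.1 eq. (3.22)] -/
theorem lintegral_displacement_slice_le {ρ : ℝ} (hρ : -2 < ρ)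
    {V V' : EuclideanSpace ℝ (Fin 3) → EuclideanSpace ℝ (Fin 3)} {P : EuclideanSpace ℝ (Fin 3) → ℝ}
    (hprof : IsSelfSimilarEulerProfile (1 / (2 + ρ)) 0 V P) {A : ℝ}
    (hA : ∀ R : ℝ, 1 ≤ R → ∫ y in ball (0 : EuclideanSpace ℝ (Fin 3)) R, ‖V y‖ ^ 2 ≤ A * R ^ (1 - 2 * ρ))
    {C L S K Rbig : ℝ} (hC : 1 ≤ C) (hL : 1 ≤ L)
    (hV' : ContDiff ℝ 2 V') (hK : ∀ y, ‖fderiv ℝ V' y‖ ≤ K) (hRbig : 2 * C * L * Real.exp (S / (2 + ρ)) < Rbig)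
    (hVV' : ∀ w ∈ ball (0 : EuclideanSpace ℝ (Fin 3)) Rbig, V' w = V w) {σ : ℝ} (hσ : σ ∈ Icc 0 S) :
    ∫⁻ y in {y ∈ ball (0 : EuclideanSpace ℝ (Fin 3)) L | ∀ σ' ∈ Icc 0 σ,
        ‖ODE.evolutionMap (fun _ : ℝ => selfSimilarTransport (1 / (2 + ρ)) (0 : EuclideanSpace ℝ (Fin 3)) V') 0 σ' y‖ ≤
          C * L * Real.exp (σ' / (2 + ρ))},
        ‖V' (ODE.evolutionMap (fun _ : ℝ => selfSimilarTransport (1 / (2 + ρ)) (0 : EuclideanSpace ℝ (Fin 3)) V') 0 σ y)‖ₑ ≤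
      ENNReal.ofReal (Real.sqrt (max A 0 * 2 ^ (1 - 2 * ρ)) *
          (Real.exp (-(3 * (1 / (2 + ρ)) * σ)) * (C * L * Real.exp (σ / (2 + ρ))) ^ (2 - ρ))) *
        volume (ball (0 : EuclideanSpace ℝ (Fin 3)) 1) ^ (1 / 2 : ℝ) := by
  have h2ρ : 0 < 2 + ρ := by linarith
  set γ : ℝ := 1 / (2 + ρ) with hγ
  have hCL : 1 ≤ C * L := by nlinarith
  have hCL0 : 0 ≤ C * L := by linarith
  obtain ⟨Φ, hΦ⟩ : ∃ Φ : ℝ → EuclideanSpace ℝ (Fin 3) → EuclideanSpace ℝ (Fin 3),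
      Φ = ODE.evolutionMap (fun _ : ℝ => selfSimilarTransport γ (0 : EuclideanSpace ℝ (Fin 3)) V') 0 := ⟨_, rfl⟩
  -- radii
  set Rσ : ℝ := C * L * Real.exp (σ / (2 + ρ)) with hRσ
  set RS : ℝ := C * L * Real.exp (S / (2 + ρ)) with hRS
  have hRσ1 : 1 ≤ Rσ := by
    have : 1 ≤ Real.exp (σ / (2 + ρ)) := Real.one_le_exp (div_nonneg hσ.1 h2ρ.le)
    nlinarith
  have hRσ0 : 0 < Rσ := by linarith
  have hσS : Rσ ≤ RS := by
    have : Real.exp (σ / (2 + ρ)) ≤ Real.exp (S / (2 + ρ)) :=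
      Real.exp_le_exp.2 (div_le_div_of_nonneg_right hσ.2 h2ρ.le)
    exact mul_le_mul_of_nonneg_left this hCL0
  have hRSbig : RS < Rbig := by
    have : 0 ≤ RS := by positivity
    linarith
  -- `V′ = V` and `div V′ = 0` on `‖z‖ ≤ RS`
  have hVeq : ∀ z : EuclideanSpace ℝ (Fin 3), ‖z‖ ≤ RS → V' z = V z := fun z hz =>
    hVV' z (by rw [mem_ball_zero_iff]; exact lt_of_le_of_lt hz hRSbig)
  have hdiv : ∀ z : EuclideanSpace ℝ (Fin 3), ‖z‖ ≤ RS → VectorCalculus.divergence V' z = 0 := by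
    intro z hz
    have hzB : z ∈ ball (0 : EuclideanSpace ℝ (Fin 3)) Rbig := by
      rw [mem_ball_zero_iff]; exact lt_of_le_of_lt hz hRSbig
    have hEq : V' =ᶠ[𝓝 z] V := Filter.eventually_of_mem (isOpen_ball.mem_nhds hzB) fun w hw => hVV' w hw
    have h0 := hprof.divFree z
    unfold VectorCalculus.divergence at h0 ⊢
    rw [hEq.fderiv_eq]; exact h0
  -- the label set
  obtain ⟨F, hF⟩ : ∃ F : Set (EuclideanSpace ℝ (Fin 3)), F = {y ∈ ball (0 : EuclideanSpace ℝ (Fin 3)) L |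
      ∀ σ' ∈ Icc 0 σ, ‖Φ σ' y‖ ≤ C * L * Real.exp (σ' / (2 + ρ))} := ⟨_, rfl⟩
  have hFm : MeasurableSet F := by
    rw [hF, show {y ∈ ball (0 : EuclideanSpace ℝ (Fin 3)) L | ∀ σ' ∈ Icc 0 σ, ‖Φ σ' y‖ ≤ C * L * Real.exp (σ' / (2 + ρ))} =
      ball (0 : EuclideanSpace ℝ (Fin 3)) L ∩ {y | ∀ σ' ∈ Icc 0 σ, ‖Φ σ' y‖ ≤ C * L * Real.exp (σ' / (2 + ρ))} by
        ext y; simp only [mem_setOf_eq, mem_inter_iff]]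
    rw [hΦ]
    exact measurableSet_ball.inter
      (isClosed_forwardStay_fun (γ := γ) hV' hK σ (fun σ' => C * L * Real.exp (σ' / (2 + ρ)))).measurableSet
  have hstay : ∀ y ∈ F, ∀ σ' ∈ Icc 0 σ, ‖Φ σ' y‖ ≤ RS := by
    intro y hy σ' hσ'
    rw [hF] at hy
    refine (hy.2 σ' hσ').trans ?_
    have : Real.exp (σ' / (2 + ρ)) ≤ Real.exp (S / (2 + ρ)) :=
      Real.exp_le_exp.2 (div_le_div_of_nonneg_right (hσ'.2.trans hσ.2) h2ρ.le)
    exact mul_le_mul_of_nonneg_left this hCL0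
  have himg : Φ σ '' F ⊆ closedBall (0 : EuclideanSpace ℝ (Fin 3)) Rσ := by
    rintro _ ⟨y, hy, rfl⟩
    rw [mem_closedBall_zero_iff]
    rw [hF] at hy
    exact hy.2 σ ⟨hσ.1, le_rfl⟩
  -- the area formula
  have hgm : Measurable fun z : EuclideanSpace ℝ (Fin 3) => ‖V' z‖ₑ := hV'.continuous.measurable.enorm
  have hVc : Continuous V := hprof.contDiff_velocity.continuous
  have harea := lintegral_comp_flow_section_eq (γ := γ) hV' hK hσ.1 hdiv hFm (by rw [hΦ] at hstay; exact hstay) hgm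
  rw [← hΦ] at harea
  have hAeq : ∫⁻ y in F, ‖V' (Φ σ y)‖ₑ =
      ENNReal.ofReal (Real.exp (-(3 * γ * σ))) * ∫⁻ z in Φ σ '' F, ‖V' z‖ₑ := by
    rw [← harea, ← mul_assoc, ← ENNReal.ofReal_mul (Real.exp_pos _).le, ← Real.exp_add,
      show -(3 * γ * σ) + 3 * γ * σ = 0 by ring, Real.exp_zero, ENNReal.ofReal_one, one_mul]
  have hB : ∫⁻ z in Φ σ '' F, ‖V' z‖ₑ ≤ ∫⁻ z in closedBall (0 : EuclideanSpace ℝ (Fin 3)) Rσ, ‖V z‖ₑ := by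
    refine (lintegral_mono_set himg).trans (le_of_eq ?_)
    refine setLIntegral_congr_fun measurableSet_closedBall (fun z hz => ?_)
    rw [mem_closedBall_zero_iff] at hz
    rw [hVeq z (hz.trans hσS)]
  -- Cauchy–Schwarz and the A-gauge on `B̄_{Rσ}`
  have hA0 : 0 ≤ A := by
    have h := hA 1 le_rfl
    have h0 : 0 ≤ ∫ y in ball (0 : EuclideanSpace ℝ (Fin 3)) 1, ‖V y‖ ^ 2 := integral_nonneg fun y => sq_nonneg _
    simp only [Real.one_rpow, mul_one] at h
    linarith
  set v₁ : ℝ≥0∞ := volume (ball (0 : EuclideanSpace ℝ (Fin 3)) 1) with hv₁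
  have hCS := setLIntegral_le_sqrt_measure_mul_sqrt (s := closedBall (0 : EuclideanSpace ℝ (Fin 3)) Rσ) hVc.measurable.enorm.aemeasurable
  have hG := lintegral_closedBall_enorm_sq_le_of_gauge (ρ := ρ) hVc hA hRσ1
  have hvol : volume (closedBall (0 : EuclideanSpace ℝ (Fin 3)) Rσ) = ENNReal.ofReal (Rσ ^ 3) * v₁ := by
    rw [hv₁, Measure.addHaar_closedBall volume (0 : EuclideanSpace ℝ (Fin 3)) hRσ0.le, finrank_euclideanSpace,
      Fintype.card_fin]
  have h2R : (2 * Rσ) ^ (1 - 2 * ρ) = 2 ^ (1 - 2 * ρ) * Rσ ^ (1 - 2 * ρ) := Real.mul_rpow (by norm_num) hRσ0.le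
  have hC' : ∫⁻ z in closedBall (0 : EuclideanSpace ℝ (Fin 3)) Rσ, ‖V z‖ₑ ≤
      ENNReal.ofReal (Real.sqrt (max A 0 * 2 ^ (1 - 2 * ρ)) * Rσ ^ (2 - ρ)) * v₁ ^ (1 / 2 : ℝ) := by
    refine hCS.trans ?_
    rw [hvol]
    calc (ENNReal.ofReal (Rσ ^ 3) * v₁) ^ (1 / 2 : ℝ) *
          (∫⁻ z in closedBall (0 : EuclideanSpace ℝ (Fin 3)) Rσ, ‖V z‖ₑ ^ 2) ^ (1 / 2 : ℝ)
        ≤ (ENNReal.ofReal (Rσ ^ 3) * v₁) ^ (1 / 2 : ℝ) * (ENNReal.ofReal (A * (2 * Rσ) ^ (1 - 2 * ρ))) ^ (1 / 2 : ℝ) := by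
          gcongr
      _ ≤ (ENNReal.ofReal (Rσ ^ 3) * v₁) ^ (1 / 2 : ℝ) * (ENNReal.ofReal (max A 0 * (2 * Rσ) ^ (1 - 2 * ρ))) ^ (1 / 2 : ℝ) := by
          gcongr
          exact le_max_left _ _
      _ = (ENNReal.ofReal (Rσ ^ 3 * (max A 0 * (2 * Rσ) ^ (1 - 2 * ρ))) * v₁) ^ (1 / 2 : ℝ) := by
          rw [← ENNReal.mul_rpow_of_nonneg _ _ (by norm_num : (0 : ℝ) ≤ 1 / 2),
            ENNReal.ofReal_mul (pow_nonneg hRσ0.le 3)]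
          congr 1
          ring
      _ = ENNReal.ofReal (Real.sqrt (max A 0 * 2 ^ (1 - 2 * ρ)) * Rσ ^ (2 - ρ)) * v₁ ^ (1 / 2 : ℝ) := by
          rw [ENNReal.mul_rpow_of_nonneg _ _ (by norm_num : (0 : ℝ) ≤ 1 / 2),
            ENNReal.ofReal_rpow_of_nonneg (by positivity) (by norm_num : (0 : ℝ) ≤ 1 / 2)]
          congr 2
          rw [h2R, show Rσ ^ 3 * (max A 0 * (2 ^ (1 - 2 * ρ) * Rσ ^ (1 - 2 * ρ))) =
            (max A 0 * 2 ^ (1 - 2 * ρ)) * (Rσ ^ 3 * Rσ ^ (1 - 2 * ρ)) by ring,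
            Real.mul_rpow (by positivity) (by positivity), ← Real.sqrt_eq_rpow]
          congr 1
          rw [← Real.rpow_natCast Rσ 3, ← Real.rpow_add hRσ0, ← Real.rpow_mul hRσ0.le]
          congr 1
          push_cast
          ring
  -- assemble
  have hfin : ∫⁻ y in F, ‖V' (Φ σ y)‖ₑ ≤
      ENNReal.ofReal (Real.sqrt (max A 0 * 2 ^ (1 - 2 * ρ)) *
          (Real.exp (-(3 * (1 / (2 + ρ)) * σ)) * (C * L * Real.exp (σ / (2 + ρ))) ^ (2 - ρ))) * v₁ ^ (1 / 2 : ℝ) := by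
    rw [hAeq]
    calc ENNReal.ofReal (Real.exp (-(3 * γ * σ))) * ∫⁻ z in Φ σ '' F, ‖V' z‖ₑ
        ≤ ENNReal.ofReal (Real.exp (-(3 * γ * σ))) *
            (ENNReal.ofReal (Real.sqrt (max A 0 * 2 ^ (1 - 2 * ρ)) * Rσ ^ (2 - ρ)) * v₁ ^ (1 / 2 : ℝ)) :=
          mul_le_mul_right (hB.trans hC') _
      _ = ENNReal.ofReal (Real.exp (-(3 * γ * σ)) * (Real.sqrt (max A 0 * 2 ^ (1 - 2 * ρ)) * Rσ ^ (2 - ρ))) *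
            v₁ ^ (1 / 2 : ℝ) := by
          rw [← mul_assoc, ← ENNReal.ofReal_mul (Real.exp_pos _).le]
      _ = ENNReal.ofReal (Real.sqrt (max A 0 * 2 ^ (1 - 2 * ρ)) *
          (Real.exp (-(3 * (1 / (2 + ρ)) * σ)) * (C * L * Real.exp (σ / (2 + ρ))) ^ (2 - ρ))) * v₁ ^ (1 / 2 : ℝ) := by
          congr 2
          rw [hRσ, hγ]
          ring
  rw [hF, hΦ] at hfin
  exact hfin

/-- ★ **THE MEAN DISPLACEMENT LAW (t59-MD, `NsregP2.R54.Trace.MeanDisplacementLaw ρ V` VERBATIM, every `ρ > −2`).**  For a self-similar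
Euler profile `(V, P)` with exponent `1/(2+ρ)` in the A-gauge, and `C, L ≥ 1`, there is `M` such that in the cut-off idiom, for every horizon
`S ≥ 0` (`2CLe^{S/(2+ρ)} < Rbig`), the label-mean over `B_L` of the physical path length `∫ e^{−σ/(2+ρ)}‖V′(Ψ_σ y)‖dσ` on tube trajectories is
`≤ M`, independently of `S`, `V′`, `K`, `Rbig`.  Tonelli over labels × time, the Jacobian `e^{3γσ}` on staying labels, Cauchy–Schwarz, the
A-gauge, and `γ(2+ρ) = 1` (`∫_0^S e^{−σ} ≤ 1`). [nsreg-p2 R54 §C t59-MD; cite: ConstantinIgnatovaVicol2026Putative, §3.4.1 eq. (3.21)–(3.22)] -/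
theorem meanDisplacementLaw {ρ : ℝ} (hρ : -2 < ρ) (V : EuclideanSpace ℝ (Fin 3) → EuclideanSpace ℝ (Fin 3)) :
    ∀ P : EuclideanSpace ℝ (Fin 3) → ℝ, IsSelfSimilarEulerProfile (1 / (2 + ρ)) 0 V P →
    ∀ A : ℝ, (∀ R : ℝ, 1 ≤ R → ∫ y in ball (0 : EuclideanSpace ℝ (Fin 3)) R, ‖V y‖ ^ 2 ≤ A * R ^ (1 - 2 * ρ)) →
    ∀ C L : ℝ, 1 ≤ C → 1 ≤ L → ∃ M : ℝ, ∀ (S : ℝ) (V' : EuclideanSpace ℝ (Fin 3) → EuclideanSpace ℝ (Fin 3)) (K Rbig : ℝ),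
      0 ≤ S → ContDiff ℝ 2 V' →
      (∀ y, ‖fderiv ℝ V' y‖ ≤ K) → 2 * C * L * Real.exp (S / (2 + ρ)) < Rbig →
      (∀ w ∈ ball (0 : EuclideanSpace ℝ (Fin 3)) Rbig, V' w = V w) →
      ∫⁻ y in ball (0 : EuclideanSpace ℝ (Fin 3)) L, ∫⁻ σ in Icc 0 S,
          indicator {σ' : ℝ | ∀ σ'' ∈ Icc 0 σ',
              ‖ODE.evolutionMap (fun _ : ℝ => selfSimilarTransport (1 / (2 + ρ)) (0 : EuclideanSpace ℝ (Fin 3)) V') 0 σ'' y‖ ≤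
                C * L * Real.exp (σ'' / (2 + ρ))}
            (fun σ' : ℝ => ENNReal.ofReal (Real.exp (-(σ' / (2 + ρ)))) * ‖V'
              (ODE.evolutionMap (fun _ : ℝ => selfSimilarTransport (1 / (2 + ρ)) (0 : EuclideanSpace ℝ (Fin 3)) V') 0 σ' y)‖ₑ) σ ≤
        ENNReal.ofReal M := by
  intro P hprof A hA C L hC hL
  have h2ρ : 0 < 2 + ρ := by linarith
  have hCL0 : 0 ≤ C * L := by nlinarith
  set γ : ℝ := 1 / (2 + ρ) with hγ
  set v₁ : ℝ≥0∞ := volume (ball (0 : EuclideanSpace ℝ (Fin 3)) 1) with hv₁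
  set Q : ℝ≥0∞ := v₁ ^ (1 / 2 : ℝ) with hQ
  have hQtop : Q ≠ ⊤ := ENNReal.rpow_ne_top_of_nonneg (by norm_num) (measure_ball_lt_top).ne
  set a : ℝ := Real.sqrt (max A 0 * 2 ^ (1 - 2 * ρ)) with ha
  have ha0 : 0 ≤ a := Real.sqrt_nonneg _
  set c : ℝ := a * (C * L) ^ (2 - ρ) with hc
  have hc0 : 0 ≤ c := mul_nonneg ha0 (Real.rpow_nonneg hCL0 _)
  refine ⟨c * Q.toReal, fun S V' K Rbig hS hV' hK hRbig hVV' => ?_⟩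
  obtain ⟨Φ, hΦ⟩ : ∃ Φ : ℝ → EuclideanSpace ℝ (Fin 3) → EuclideanSpace ℝ (Fin 3),
      Φ = ODE.evolutionMap (fun _ : ℝ => selfSimilarTransport γ (0 : EuclideanSpace ℝ (Fin 3)) V') 0 := ⟨_, rfl⟩
  rw [← hΦ]
  -- measurability on `labels × time`
  obtain ⟨T, hT⟩ : ∃ T : Set (EuclideanSpace ℝ (Fin 3) × ℝ),
      T = {p | ∀ σ'' ∈ Icc 0 p.2, ‖Φ σ'' p.1‖ ≤ C * L * Real.exp (σ'' / (2 + ρ))} := ⟨_, rfl⟩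
  have hTm : MeasurableSet T := by
    rw [hT, hΦ]
    exact measurableSet_forwardStayProd (γ := γ) hV' hK (f := fun σ'' => C * L * Real.exp (σ'' / (2 + ρ))) (by fun_prop)
  have hHm : Measurable fun p : EuclideanSpace ℝ (Fin 3) × ℝ =>
      ENNReal.ofReal (Real.exp (-(p.2 / (2 + ρ)))) * ‖V' (Φ p.2 p.1)‖ₑ := by
    rw [hΦ]
    refine (ENNReal.measurable_ofReal.comp (by fun_prop : Measurable fun p : EuclideanSpace ℝ (Fin 3) × ℝ =>
      Real.exp (-(p.2 / (2 + ρ))))).mul ?_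
    exact (hV'.continuous.comp ((continuous_flow_uncurry (γ := γ) hV' hK).comp
      (continuous_snd.prodMk continuous_fst))).measurable.enorm
  have hunc : (Function.uncurry fun (y : EuclideanSpace ℝ (Fin 3)) (σ : ℝ) =>
      indicator {σ' : ℝ | ∀ σ'' ∈ Icc 0 σ', ‖Φ σ'' y‖ ≤ C * L * Real.exp (σ'' / (2 + ρ))}
        (fun σ' : ℝ => ENNReal.ofReal (Real.exp (-(σ' / (2 + ρ)))) * ‖V' (Φ σ' y)‖ₑ) σ) =
      T.indicator fun p => ENNReal.ofReal (Real.exp (-(p.2 / (2 + ρ)))) * ‖V' (Φ p.2 p.1)‖ₑ := by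
    funext p
    obtain ⟨y, σ⟩ := p
    rw [hT, Function.uncurry_apply_pair]
    by_cases h : ∀ σ'' ∈ Icc 0 σ, ‖Φ σ'' y‖ ≤ C * L * Real.exp (σ'' / (2 + ρ))
    · rw [indicator_of_mem (show σ ∈ {σ' : ℝ | ∀ σ'' ∈ Icc 0 σ', ‖Φ σ'' y‖ ≤ C * L * Real.exp (σ'' / (2 + ρ))} from h),
        indicator_of_mem (show (y, σ) ∈ {p : EuclideanSpace ℝ (Fin 3) × ℝ |
          ∀ σ'' ∈ Icc 0 p.2, ‖Φ σ'' p.1‖ ≤ C * L * Real.exp (σ'' / (2 + ρ))} from h)]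
    · rw [indicator_of_notMem (show σ ∉ {σ' : ℝ | ∀ σ'' ∈ Icc 0 σ', ‖Φ σ'' y‖ ≤ C * L * Real.exp (σ'' / (2 + ρ))} from h),
        indicator_of_notMem (show (y, σ) ∉ {p : EuclideanSpace ℝ (Fin 3) × ℝ |
          ∀ σ'' ∈ Icc 0 p.2, ‖Φ σ'' p.1‖ ≤ C * L * Real.exp (σ'' / (2 + ρ))} from h)]
  have hmeas : AEMeasurable (Function.uncurry fun (y : EuclideanSpace ℝ (Fin 3)) (σ : ℝ) =>
      indicator {σ' : ℝ | ∀ σ'' ∈ Icc 0 σ', ‖Φ σ'' y‖ ≤ C * L * Real.exp (σ'' / (2 + ρ))}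
        (fun σ' : ℝ => ENNReal.ofReal (Real.exp (-(σ' / (2 + ρ)))) * ‖V' (Φ σ' y)‖ₑ) σ)
      ((volume.restrict (ball (0 : EuclideanSpace ℝ (Fin 3)) L)).prod (volume.restrict (Icc 0 S))) := by
    rw [hunc]
    exact (hHm.indicator hTm).aemeasurable
  -- Tonelli
  rw [lintegral_lintegral_swap hmeas]
  -- the slice bound
  have hslice : ∀ σ ∈ Icc (0 : ℝ) S, ∫⁻ y in ball (0 : EuclideanSpace ℝ (Fin 3)) L,
      indicator {σ' : ℝ | ∀ σ'' ∈ Icc 0 σ', ‖Φ σ'' y‖ ≤ C * L * Real.exp (σ'' / (2 + ρ))}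
        (fun σ' : ℝ => ENNReal.ofReal (Real.exp (-(σ' / (2 + ρ)))) * ‖V' (Φ σ' y)‖ₑ) σ ≤
      ENNReal.ofReal (c * Real.exp (-σ)) * Q := by
    intro σ hσ
    have hSm : MeasurableSet {y : EuclideanSpace ℝ (Fin 3) | ∀ σ'' ∈ Icc 0 σ, ‖Φ σ'' y‖ ≤ C * L * Real.exp (σ'' / (2 + ρ))} := by
      rw [hΦ]
      exact (isClosed_forwardStay_fun (γ := γ) hV' hK σ (fun σ' => C * L * Real.exp (σ' / (2 + ρ)))).measurableSet
    have e1 : ∀ y : EuclideanSpace ℝ (Fin 3),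
        indicator {σ' : ℝ | ∀ σ'' ∈ Icc 0 σ', ‖Φ σ'' y‖ ≤ C * L * Real.exp (σ'' / (2 + ρ))}
          (fun σ' : ℝ => ENNReal.ofReal (Real.exp (-(σ' / (2 + ρ)))) * ‖V' (Φ σ' y)‖ₑ) σ =
        indicator {y : EuclideanSpace ℝ (Fin 3) | ∀ σ'' ∈ Icc 0 σ, ‖Φ σ'' y‖ ≤ C * L * Real.exp (σ'' / (2 + ρ))}
          (fun y => ENNReal.ofReal (Real.exp (-(σ / (2 + ρ)))) * ‖V' (Φ σ y)‖ₑ) y := by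
      intro y
      by_cases h : ∀ σ'' ∈ Icc 0 σ, ‖Φ σ'' y‖ ≤ C * L * Real.exp (σ'' / (2 + ρ))
      · rw [indicator_of_mem (show σ ∈ {σ' : ℝ | ∀ σ'' ∈ Icc 0 σ', ‖Φ σ'' y‖ ≤ C * L * Real.exp (σ'' / (2 + ρ))} from h),
          indicator_of_mem (show y ∈ {y : EuclideanSpace ℝ (Fin 3) |
            ∀ σ'' ∈ Icc 0 σ, ‖Φ σ'' y‖ ≤ C * L * Real.exp (σ'' / (2 + ρ))} from h)]
      · rw [indicator_of_notMem (show σ ∉ {σ' : ℝ | ∀ σ'' ∈ Icc 0 σ', ‖Φ σ'' y‖ ≤ C * L * Real.exp (σ'' / (2 + ρ))} from h),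
          indicator_of_notMem (show y ∉ {y : EuclideanSpace ℝ (Fin 3) |
            ∀ σ'' ∈ Icc 0 σ, ‖Φ σ'' y‖ ≤ C * L * Real.exp (σ'' / (2 + ρ))} from h)]
    simp_rw [e1]
    rw [lintegral_indicator hSm, Measure.restrict_restrict hSm]
    have eF : {y : EuclideanSpace ℝ (Fin 3) | ∀ σ'' ∈ Icc 0 σ, ‖Φ σ'' y‖ ≤ C * L * Real.exp (σ'' / (2 + ρ))} ∩
        ball (0 : EuclideanSpace ℝ (Fin 3)) L =
        {y ∈ ball (0 : EuclideanSpace ℝ (Fin 3)) L | ∀ σ' ∈ Icc 0 σ, ‖Φ σ' y‖ ≤ C * L * Real.exp (σ' / (2 + ρ))} := by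
      ext y; simp only [mem_inter_iff, mem_setOf_eq]; tauto
    rw [eF, lintegral_const_mul' _ _ ENNReal.ofReal_ne_top]
    have h := lintegral_displacement_slice_le hρ hprof hA hC hL hV' hK hRbig hVV' hσ
    rw [← hΦ] at h
    calc ENNReal.ofReal (Real.exp (-(σ / (2 + ρ)))) *
          ∫⁻ y in {y ∈ ball (0 : EuclideanSpace ℝ (Fin 3)) L | ∀ σ' ∈ Icc 0 σ, ‖Φ σ' y‖ ≤ C * L * Real.exp (σ' / (2 + ρ))},
            ‖V' (Φ σ y)‖ₑ
        ≤ ENNReal.ofReal (Real.exp (-(σ / (2 + ρ)))) *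
            (ENNReal.ofReal (a * (Real.exp (-(3 * (1 / (2 + ρ)) * σ)) * (C * L * Real.exp (σ / (2 + ρ))) ^ (2 - ρ))) * Q) :=
          mul_le_mul_right h _
      _ = ENNReal.ofReal (a * (Real.exp (-(σ / (2 + ρ))) *
            (Real.exp (-(3 * (1 / (2 + ρ)) * σ)) * (C * L * Real.exp (σ / (2 + ρ))) ^ (2 - ρ)))) * Q := by
          rw [← mul_assoc, ← ENNReal.ofReal_mul (Real.exp_pos _).le]
          congr 2
          ring
      _ = ENNReal.ofReal (c * Real.exp (-σ)) * Q := by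
          rw [displacement_bookkeeping h2ρ hCL0, hc]
          congr 2
          ring
  calc ∫⁻ σ in Icc 0 S, ∫⁻ y in ball (0 : EuclideanSpace ℝ (Fin 3)) L,
        indicator {σ' : ℝ | ∀ σ'' ∈ Icc 0 σ', ‖Φ σ'' y‖ ≤ C * L * Real.exp (σ'' / (2 + ρ))}
          (fun σ' : ℝ => ENNReal.ofReal (Real.exp (-(σ' / (2 + ρ)))) * ‖V' (Φ σ' y)‖ₑ) σ
      ≤ ∫⁻ σ in Icc 0 S, ENNReal.ofReal (c * Real.exp (-σ)) * Q := setLIntegral_mono' measurableSet_Icc hslice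
    _ = (∫⁻ σ in Icc 0 S, ENNReal.ofReal (Real.exp (-σ))) * (ENNReal.ofReal c * Q) := by
        rw [← lintegral_mul_const' _ _ (ENNReal.mul_ne_top ENNReal.ofReal_ne_top hQtop)]
        refine lintegral_congr fun σ => ?_
        rw [ENNReal.ofReal_mul hc0]
        ring
    _ ≤ ENNReal.ofReal 1 * (ENNReal.ofReal c * Q) := mul_le_mul_left (lintegral_exp_neg_Icc_le hS) _
    _ = ENNReal.ofReal (c * Q.toReal) := by
        rw [ENNReal.ofReal_one, one_mul, ENNReal.ofReal_mul hc0, ENNReal.ofReal_toReal hQtop]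

end Summit.NavierStokesRegularity.NavierStokesRegularity.Theorems.PowerGaugeEulerLiouville.Trace
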